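import Literature.NumberTheory.EllipticCurves.PAdicOneVariableSeriesFamilyOfRelNormCoherentUnits
import Literature.NumberTheory.EllipticCurves.PAdicOneVariableSocketCoatesWilesTwo
import Literature.NumberTheory.GaloisRepresentations.LubinTateColemanCoordMomentsTwistTwo
import HarnessLib

/-!
# `p = 2`: the whole COLEMAN COORDINATE MODULE `𝒪_E⟦Y⟧` is an additive `[κ]`-equivariant series family of the
# measure lane — `φ(r) := j(Φ r)`, `Φ(r) = (1 + u⁻¹X)·(r ∘ f′)` — with the socket; it EXTENDS the family of the
# norm-coherent units (`Φ(r_β) = (δ_E g_β)~`) and its socket moments are the Coleman lane's `mom_k` (junction (J-i))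

Topic `NumberTheory/EllipticCurves`; namespace `Literature.NumberTheory.EllipticCurves`.

De Shalit, *Iwasawa theory of elliptic curves with complex multiplication* (1987), I.3.4 Lemma (i)/(ii) and
Corollary (`i` extends by linearity to `𝒰 ⊗̂ 𝐃 → Λ`), I.3.5 (11), I.3.7 (`i : 𝒰 ⊗̂ 𝐃 ≅ Λ₁`, the image is the
module of ALL trace-zero series `(1 + tX)·𝒪⟦f⟧`).  The β-agnostic series-family files
(`PAdicOneVariableSeriesFamily{OfCharacter, MomentsOfCharacter, GlueOfCharacter}`: `i := induce D` for a family
`φ : B → 𝐃⟦X⟧` with `hadd`/`hgal`/`hsock`) were instantiated for the norm-coherent UNITS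
(`PAdicOneVariableSeriesFamilyOf(Rel)NormCoherentUnits`: `φ b = j((δ_E g_{η b})~)`).  The Coleman lane
(`LubinTateColemanRelativeCoordTwo`, `…CoordMoments(Twist)Two`) parametrises ALL trace-zero series by the
coordinate module: `ker 𝒮_E = Φ(𝒪_E⟦Y⟧)`, `Φ(r) = (1 + u⁻¹X)·(r ∘ f′)` (`coordToKer`), with `(δ_E g_β)~ = Φ(r_β)`.
THIS file instantiates the series-family hypotheses for the WHOLE MODULE (everything proved, 0 sorry, no defs):

* §1 `relTraceTwo_coordToKer` (**`𝒮_E(Φ r) = 0`** for every `r`), `map_coordToKer_add`,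
  ★ `map_coordToKer_twist` — **`j(Φ(σ_a r)) = C(ι a) · (j(Φ r) ∘ homC' a)`** (Lemma I.3.4 (ii) on the module, from
  `coordToKer_twist`), `map_coordToKer_relUnitCoordTwo` (**`j(Φ(r_β)) = j((δ_E g_β)~)`**: the module family EXTENDS
  the unit family along the Coleman coordinate `β ↦ r_β`);
* §2 ★ `seriesFamily_hadd_of_coordModule`, ★ `seriesFamily_hgal_of_coordModule` — the hypotheses `hadd`/`hgal`
  VERBATIM for `φ b := j(Φ(η b))`, any `η : B → 𝒪_E⟦Y⟧` additive with `η(g • b) = σ_a(η b)`, `e(a) = κ g`;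
* §3 ★ `seriesFamily_hsock_of_coordModule` — the SOCKET `∫_{ℤ₂ˣ} x^{k+1} d((x⁻¹ D_{H})|_{ℤ₂ˣ}) = [S⁰] D^k H` for
  `H = Θ(j(Φ r) ∘ ϑ)`, EVERY `r` (trace zero ⟹ support on `ℤ₂ˣ`);
* §4 ★★ `constantCoeff_mahlerD_iterate_subst_compSeriesC_coordToKer` — **`[S⁰] D^k (j(Φ r) ∘ ϑ) = ε^k · j(mom_k(r))`**:
  the socket moments of the module family ARE the Coleman lane's moment functionals `coordMoment k`
  (`ε = ϑ′(0) = Ω_p`); with `coordMoment_smul` (cf. `LubinTateColemanCoordMomentsLinearTwo`) the measure attached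
  to `c • r` has moments `ε^k j(c(γ^{k+1} − 1) mom_k(r))`.

So de Shalit's `i = induce D` is defined on all of `M ⊇ Col(𝒰)` by the SAME package, and `i ∘ Col⁻¹`-questions
become questions about `Φ`; the Galois side (`induce`, II.4.6) is untouched.  Cell `bsd-print-cf2`, width seat
`bsd-line-cf2c-w7` g13.

## References

* [deShalit1987] E. de Shalit, *Iwasawa theory of elliptic curves with complex multiplication* (1987),
  I.3.3 (7) (p. 17), I.3.4 Lemma (i), (ii) and Corollary (p. 18), I.3.5 (11) (p. 18), I.3.7 (p. 19–20),
  II.4.6 (14) (p. 59).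
-/

noncomputable section

open MvPowerSeries

namespace Literature.NumberTheory.EllipticCurves

section SeriesFamilyOfColemanCoordModule

open ValuativeRel IsLocalRing Field
open Literature.NumberTheory.GaloisRepresentations Literature.NumberTheory.GaloisRepresentations.IsNonarchimedeanLocalField
  Literature.NumberTheory.GaloisRepresentations.LubinTate Literature.NumberTheory.PAdicHodge

variable {F : Type} [Field F] [ValuativeRel F] [TopologicalSpace F] [IsNonarchimedeanLocalField F]

attribute [local instance] ltNormUniformSpace ltNormIsUniformAddGroup rk1 nF nE fintypeResidueField

variable (h2 : (valuation F).IsUniformizer (((2 : ℕ) : 𝒪[F]) : F)) (u : 𝒪[F]ˣ)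
variable (E : IntermediateField F (AlgebraicClosure F)) [FiniteDimensional F E]
  (hq : residueFieldCard F = 2)
  (u' : (LTCoeff F)ˣ) (hu' : LTCoeff.of F ((u : 𝒪[F]) * ((2 : ℕ) : 𝒪[F])) = residueFieldCard F * u')
  (j : unitBall E →+* UnrCoeff F)
  (hj : j.comp (algebraMap (LTCoeff F) (unitBall E)) = (intToUnrCoeff F).comp (LTCoeff.of F).symm.toRingHom)

/-! ### §1. `Φ(r)` is trace-zero; additivity; the twist; `Φ(r_β) = (δ_E g_β)~` -/

include hu' in
/-- **`𝒮_E(Φ r) = 0` for every `r ∈ 𝒪_E⟦Y⟧`** (`ker 𝒮_E = (1 + u′⁻¹X)·𝒪_E⟦f′⟧`, `relTraceTwo_eq_zero_iff`).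
[cite: deShalit1987, I.3.3 (7) (p. 17), I.3.7 (p. 19)] -/
theorem relTraceTwo_coordToKer (r : PowerSeries (unitBall E)) :
    relTraceTwo (isUniformizer_unit_mul h2 u) E hq (coordToKer (isUniformizer_unit_mul h2 u) E u' r) = 0 :=
  (relTraceTwo_eq_zero_iff (isUniformizer_unit_mul h2 u) E hq (two_eq_of_mul_inv hq u' hu') _).mpr ⟨r, rfl⟩

/-- **`j(Φ(r + r′)) = j(Φ r) + j(Φ r′)`**. [cite: deShalit1987, I.3.4 Lemma (i) (p. 18)] -/
theorem map_coordToKer_add (r r' : PowerSeries (unitBall E)) :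
    (coordToKer (isUniformizer_unit_mul h2 u) E u' (r + r')).map j =
      (coordToKer (isUniformizer_unit_mul h2 u) E u' r).map j + (coordToKer (isUniformizer_unit_mul h2 u) E u' r').map j := by
  rw [coordToKer_add, map_add]

include hj in
/-- `j` is the identity on `𝒪_F`: `j(a) = ι(a)` for `a ∈ 𝒪_F` (private plumbing, as in the sibling file). [folklore] -/
private theorem map_algebraMap_integer_eq_intToUnrCoeff' (a : 𝒪[F]) :
    j (algebraMap 𝒪[F] (unitBall E) a) = intToUnrCoeff F a := by
  have h := RingHom.congr_fun hj (LTCoeff.of F a)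
  exact h

include hu' hj in
/-- ★ **`j(Φ(σ_a r)) = C(ι a) · (j(Φ r) ∘ homC' a)`** for every unit `a ∈ 𝒪_F^×` and every `r` (`σ_a r = D_a r + r` the unit
twist of the coordinate module; `coordToKer_twist` pushed through `j`) — Lemma I.3.4 (ii) on the whole module.
[cite: deShalit1987, I.3.4 Lemma (ii) (p. 18), I.2.3 (iv) (p. 14)] -/
theorem map_coordToKer_twist (a : 𝒪[F]ˣ) (r : PowerSeries (unitBall E)) :
    (coordToKer (isUniformizer_unit_mul h2 u) E u'
        (twistLinearBase (isUniformizer_unit_mul h2 u) hq (algebraMap (LTCoeff F) (unitBall E)) u' a r + r)).map j =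
      PowerSeries.C (intToUnrCoeff F (a : 𝒪[F])) *
        PowerSeries.subst (homC' h2 u (a : 𝒪[F])) ((coordToKer (isUniformizer_unit_mul h2 u) E u' r).map j) := by
  rw [coordToKer_twist (isUniformizer_unit_mul h2 u) E hq u' hu' a r, map_mul, PowerSeries.map_C,
    map_algebraMap_integer_eq_intToUnrCoeff' E j hj, map_subst_homE_eq_subst_homC' h2 u E j hj]

section Units

variable [Normal F E] [IsGalois F E] (hE : E ≤ maxUnramified F) {σ₀ : absoluteGaloisGroup F} (hσ₀ : IsAbsArithFrob σ₀)

include hu' in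
/-- ★ **The module family EXTENDS the unit family**: `j(Φ(r_β)) = j((δ_E g_β)~)` for every relative norm-coherent unit `β`
(`(δ_E g_β)~ = Φ(r_β)`, `relTildeSeries_eq_relUnitCoordTwo`). [cite: deShalit1987, I.3.7 (p. 19–20), II.4.6 (14) (p. 59)] -/
theorem map_coordToKer_relUnitCoordTwo (β : RelNormCoherentUnits (isUniformizer_unit_mul h2 u) E) :
    (coordToKer (isUniformizer_unit_mul h2 u) E u'
        (relUnitCoordTwo (isUniformizer_unit_mul h2 u) E hq hE hσ₀ u' hu' β)).map j =
      (relTildeSeries (isUniformizer_unit_mul h2 u) E hq hE hσ₀ (u' : LTCoeff F) β).map j := by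
  rw [relTildeSeries_eq_relUnitCoordTwo (isUniformizer_unit_mul h2 u) E hq hE hσ₀ u' hu' β]
  rfl

include hu' in
/-- Unmapped form: `Φ(r_β) = (δ_E g_β)~`. [cite: deShalit1987, I.3.7 (p. 19–20)] -/
theorem coordToKer_relUnitCoordTwo (β : RelNormCoherentUnits (isUniformizer_unit_mul h2 u) E) :
    coordToKer (isUniformizer_unit_mul h2 u) E u' (relUnitCoordTwo (isUniformizer_unit_mul h2 u) E hq hE hσ₀ u' hu' β) =
      relTildeSeries (isUniformizer_unit_mul h2 u) E hq hE hσ₀ (u' : LTCoeff F) β := by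
  rw [relTildeSeries_eq_relUnitCoordTwo (isUniformizer_unit_mul h2 u) E hq hE hσ₀ u' hu' β]
  rfl

end Units

/-! ### §2. The hypotheses `hadd` / `hgal` of the series-family files for the coordinate module -/

variable {G : Type*} [Group G] {𝒰 : SubgroupTower G} (κ : G →* ℤ_[2]ˣ) (e : 𝒪[F] →+* ℤ_[2])
variable {B : Type*} [CommMonoid B] [MulDistribMulAction G B]
  (η : B → PowerSeries (unitBall E))
  (hηmul : ∀ b b' : B, η (b * b') = η b + η b')
  (hη : ∀ g ∈ 𝒰.U 0, ∀ b : B, ∃ a : 𝒪[F]ˣ,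
    η (g • b) = twistLinearBase (isUniformizer_unit_mul h2 u) hq (algebraMap (LTCoeff F) (unitBall E)) u' a (η b) + η b ∧
    Units.map (e : 𝒪[F] →* ℤ_[2]) a = κ g)

include hηmul in
/-- ★ **`hadd` of the series-family files for the coordinate module**: `b ↦ j(Φ(η b))` is additive for an additive `η`.
[cite: deShalit1987, I.3.4 Lemma (i) (p. 18), I.3.4 Corollary (p. 18)] -/
theorem seriesFamily_hadd_of_coordModule (b b' : B) :
    (coordToKer (isUniformizer_unit_mul h2 u) E u' (η (b * b'))).map j =
      (coordToKer (isUniformizer_unit_mul h2 u) E u' (η b)).map j + (coordToKer (isUniformizer_unit_mul h2 u) E u' (η b')).map j := by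
  rw [hηmul]; exact map_coordToKer_add h2 u E u' j (η b) (η b')

include hu' hj hη in
/-- ★ **`hgal` of the series-family files for the coordinate module**: if `g ∈ U_0` acts on `η b` through the unit twist
`σ_a` with `e(a) = κ g`, then `j(Φ(η(g•b))) = C(ι a) · (j(Φ(η b)) ∘ homC' a)`. [cite: deShalit1987, I.3.4 Lemma (ii) (p. 18), II.4.6 (14) (p. 59)] -/
theorem seriesFamily_hgal_of_coordModule :
    ∀ g ∈ 𝒰.U 0, ∀ b : B, ∃ a : 𝒪[F], (κ g : ℤ_[2]) = e a ∧
      (coordToKer (isUniformizer_unit_mul h2 u) E u' (η (g • b))).map j =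
        PowerSeries.C (intToUnrCoeff F a) * PowerSeries.subst (homC' h2 u a)
          ((coordToKer (isUniformizer_unit_mul h2 u) E u' (η b)).map j) := by
  intro g hg b
  obtain ⟨a, ha, hκ⟩ := hη g hg b
  refine ⟨(a : 𝒪[F]), ?_, ?_⟩
  · rw [← hκ]; rfl
  · rw [ha]; exact map_coordToKer_twist h2 u E hq u' hu' j hj a (η b)

/-! ### §3. The socket `hsock` (de Shalit's (11)) for the coordinate module -/

variable {σ₀ : absoluteGaloisGroup F} (hσ₀ : IsAbsArithFrob σ₀) {ε : (maxUnramifiedCompletion F)ˣ}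
  (hε : maxUnramifiedCompletion.galAut F σ₀ (ε : maxUnramifiedCompletion F) =
    algebraMap 𝒪[F] (maxUnramifiedCompletion F) (u : 𝒪[F]) * (ε : maxUnramifiedCompletion F))
variable (θ : CompletedAlgClosure F →+* ℂ_[2]) (hθc : Continuous θ)
  (hθ1 : ∀ z : CBall F, ‖θ (z : CompletedAlgClosure F)‖ ≤ 1)
  (hθζ : ∀ ζ' : ℂ_[2], (∃ n : ℕ, ζ' ^ 2 ^ n = 1) →
    ∃ ζ : CompletedAlgClosure F, (∃ n : ℕ, ζ ^ 2 ^ n = 1) ∧ θ ζ = ζ')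
  (hjC : (algebraMap (UnrCoeff F) (CBall F)).comp j = unitBallToCBall E)

include hq hu' hθc hθ1 hθζ hjC in
/-- ★ **`hsock` for the coordinate module** (`Θ = θ ∘ subtype ∘ algebraMap`, ANY bound proof in the `Θ`-currency): for EVERY
`r ∈ 𝒪_E⟦Y⟧`, `∫_{ℤ₂ˣ} x^{k+1} d((x⁻¹ D_{H})|_{ℤ₂ˣ}) = [S⁰] D^k H` with `H = Θ(j(Φ r) ∘ ϑ)` — because `𝒮_E(Φ r) = 0`.
[cite: deShalit1987, I.3.5 (11) (p. 18), I.3.3 (7)–(8) (p. 17), I.3.7 (p. 19)] -/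
theorem seriesFamily_hsock_of_coordModule (r : PowerSeries (unitBall E)) {C : ℝ}
    (hC : ∀ k : ℕ, ‖PowerSeries.coeff k ((PowerSeries.subst (compSeriesC h2 hσ₀ u hε)
      ((coordToKer (isUniformizer_unit_mul h2 u) E u' r).map j)).map
      (θ.comp ((CBall F).subtype.comp (algebraMap (UnrCoeff F) (CBall F)))))‖ ≤ C) (k : ℕ) :
    (restrictUnits ((invAmice₁ 2 ((PowerSeries.subst (compSeriesC h2 hσ₀ u hε)
        ((coordToKer (isUniformizer_unit_mul h2 u) E u' r).map j)).map
        (θ.comp ((CBall F).subtype.comp (algebraMap (UnrCoeff F) (CBall F))))) hC).density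
        (ProfiniteTower.padicInt_isUniform 2) (unitInv ℂ_[2]) uniformContinuous_unitInv norm_unitInv_le)).integral
        (fun x : ℤ_[2] ↦ padicIntCast ℂ_[2] (x ^ (k + 1))) =
      PowerSeries.constantCoeff (mahlerD^[k] ((PowerSeries.subst (compSeriesC h2 hσ₀ u hε)
        ((coordToKer (isUniformizer_unit_mul h2 u) E u' r).map j)).map
        (θ.comp ((CBall F).subtype.comp (algebraMap (UnrCoeff F) (CBall F)))))) := by
  have hbridge := map_subst_compSeriesC_map_eq h2 u E hσ₀ j hε θ hjC (coordToKer (isUniformizer_unit_mul h2 u) E u' r)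
  have h₁ := invAmice₁_μ_congr (p := 2) hbridge hC (norm_coeff_map_le_one θ hθ1 _)
  have h₂ := BoundedDistribution.density_μ_congr_of_μ_eq _ _ h₁ (ProfiniteTower.padicInt_isUniform 2)
    (unitInv ℂ_[2]) uniformContinuous_unitInv norm_unitInv_le
  have h₃ := restrictUnits_μ_congr_of_μ_eq _ _ h₂
  rw [BoundedDistribution.integral_congr_of_μ_eq _ _ h₃, hbridge]
  exact integral_restrictUnits_density_unitInv_pow_succ_of_relTraceTwo_eq_zero hq h2 hσ₀ u hε θ hθc hθ1 hθζ E _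
    (relTraceTwo_coordToKer h2 u E hq u' hu' r) k

/-! ### §4. The socket moments of the module family are the Coleman lane's `mom_k` -/

include hq hj in
/-- ★★ **`[S⁰] D^k (j(Φ r) ∘ ϑ) = ε^k · j(mom_k(r))`** for EVERY `r ∈ 𝒪_E⟦Y⟧` (`ε = [S]ϑ = Ω_p`; `D = (1+S)d/dS`;
`mom_k = coordMoment k` the Coleman lane's moment functional) — the junction (J-i) at the level of moments, on the whole
coordinate module. [cite: deShalit1987, I.3.5 (11) (p. 18), II.4.7 (16)–(17) (p. 60)] -/
theorem constantCoeff_mahlerD_iterate_subst_compSeriesC_coordToKer (k : ℕ) (r : PowerSeries (unitBall E)) :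
    PowerSeries.constantCoeff (mahlerD^[k] (((coordToKer (isUniformizer_unit_mul h2 u) E u' r).map j).subst (compSeriesC h2 hσ₀ u hε))) =
      PowerSeries.coeff 1 (compSeriesC h2 hσ₀ u hε) ^ k * j (coordMoment (isUniformizer_unit_mul h2 u) E u' k r) :=
  constantCoeff_mahlerD_iterate_subst_compSeriesC_map hq h2 hσ₀ u hε E j hj k _

include hq hu' hj in
/-- **Twisted form of the moment junction**: `[S⁰] D^k (j(Φ(σ_a r)) ∘ ϑ) = ε^k · j(a^{k+1} · mom_k(r))`
(`coordMoment_twist`). [cite: deShalit1987, I.3.4 Lemma (ii), I.3.5 (ii) (p. 18)] -/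
theorem constantCoeff_mahlerD_iterate_subst_compSeriesC_coordToKer_twist (k : ℕ) (a : 𝒪[F]ˣ) (r : PowerSeries (unitBall E)) :
    PowerSeries.constantCoeff (mahlerD^[k] (((coordToKer (isUniformizer_unit_mul h2 u) E u'
        (twistLinearBase (isUniformizer_unit_mul h2 u) hq (algebraMap (LTCoeff F) (unitBall E)) u' a r + r)).map j).subst
        (compSeriesC h2 hσ₀ u hε))) =
      PowerSeries.coeff 1 (compSeriesC h2 hσ₀ u hε) ^ k *
        j (algebraMap 𝒪[F] (unitBall E) (a : 𝒪[F]) ^ (k + 1) * coordMoment (isUniformizer_unit_mul h2 u) E u' k r) := by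
  rw [constantCoeff_mahlerD_iterate_subst_compSeriesC_coordToKer h2 u E hq u' j hj hσ₀ hε, coordMoment_twist _ E hq u' hu']

end SeriesFamilyOfColemanCoordModule

end Literature.NumberTheory.EllipticCurves
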